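import Summits.BirchSwinnertonDyer.BirchSwinnertonDyer.Theorems.EisensteinPrimesMazurMCOnCellBTwistbackLamOneRankOne
import Summits.BirchSwinnertonDyer.Rank1Residual.X2.RankOneNonsplitTransfer
import Summits.BirchSwinnertonDyer.Rank1Residual.X2.RankOne
import Literature.NumberTheory.EllipticCurves.Disegni2020.PAdicGrossZagierNonsplit
import Literature.NumberTheory.EllipticCurves.BSDSelmerPConverseRankOneRubinProofs
import Literature.NumberTheory.EllipticCurves.NonvanishingTwistsWaldspurgerOfHoffsteinLuo
import Literature.NumberTheory.EllipticCurves.HeegnerPointsModularityProofs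
import Literature.NumberTheory.EllipticCurves.BSDRootNumberModularityOnlyProofs
import Literature.NumberTheory.EllipticCurves.BSDRootNumberOddParityProofs
import Literature.NumberTheory.EllipticCurves.GlobalMinimalModelProofs
import Literature.NumberTheory.EllipticCurves.BSDSelmerSkinnerThmBProofs
import Literature.NumberTheory.EllipticCurves.LeadingTermPPartProofs
import Literature.NumberTheory.EllipticCurves.Rank1Residual.ClassX1KellerYinTypeA
import HarnessLib

/-!
# `ord_{T=0} L_p(E, T) = 1 ⟹ ord_{s=1} L(E, s) = 1` at a NON-SPLIT multiplicative prime, from PUBLISHED inputs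
# only: Perrin-Riou's 1987 argument run with Disegni's `p`-adic Gross–Zagier formula (no Selmer group, no
# parity, no `p`-converse)

Width seat bsd-line-x2-p1-w3 (g11), 2026-08-28, for crux 3 `MazurMCOnCellB` (stmt-BirchSwinnertonDyer-19033), line
`twistback` v5. HONEST FRAMING (cell `bsd-eis`, run/shared/lean/pub/bsd-eis/): conditional theorems only; named facts BY
NAME — Disegni 2020 §2.2 Thm. (`p`-adic Gross–Zagier formula) = Thm. 2.4 at a non-split multiplicative prime
(`Disegni2020.padicGrossZagier_nonsplitMult`, PUB, filed by this seat), Gross–Zagier 1986 (`gross_zagier`), the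
Modularity Theorem (`exists_isNewformOf`, `nonempty_modularParametrizationData`), Hoffstein–Luo 1997
(`HoffsteinLuo1997_exists_twist_L_one_ne_zero`) and — only in §3 — Wuthrich 2014 Thm. 16
(`thm16_charIdeal_dvd_multiplicative_of_reducible`); ALL of them conjuncts of the route's `PublishedInputs`
(stmt-…-19037) except the first. No `def`, no `sorry`; nothing about any curve is proved unconditionally; no main
conjecture / BSD; 0 cells / labels / stubs / tiers move.

WHY. On the sub-row «`p = 3` non-split, local balance `1`» of crux 3 the chain of LEAD g10/g11 and w5/w7/w3 reaches
`(μ_an, λ_an)(E^K) = (0, 1)` for THE non-split Mazur–Tate–Teitelbaum function of the partner `E^K` from PUBLISHED inputs,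
and then needs `ord_{s=1} L(E^K, s) = 1`. So far that last step went «`λ = 1` ⟹ corank Sel ≤ 1 (Kato/Wuthrich) ⟹
`= 1` (Dokchitser) ⟹ `r_an = 1` by Keller–Yin Thm. E», an UNREFEREED `p`-converse (`…LamOneRankOne` §3,
`…OrderOneRankOne` §1). This file replaces it by the classical route of Perrin-Riou (Invent. Math. 89 (1987) §1.4;
Greenberg LNM 1716 §4 p. 111; in the tree for GOOD ordinary `p`:
`BSDSelmerPConverseRankOneRubinProofs.analyticRank_eq_one_of_order_padicLFunction_eq_one`), which needs a `p`-adic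
Gross–Zagier formula at the prime in question — at a non-split multiplicative prime that is Disegni's (Kyoto J. Math.
60 (2020) Thm. 2.4, after Compositio 153 (2017) Thm. B; the SAME theorem behind the tree's
`padicBSD_rankOne_nonsplitMult`): `ord_{T=0} L_p(E,T) = 1` gives `L(E,1) = 0`; an auxiliary imaginary quadratic `K'`
with every prime of `N_E` split (so `p` split) and `L(E^{(d_{K'})}, 1) ≠ 0` exists when `w(E) = −1` (Hoffstein–Luo +
sign, tree theorem `friedbergHoffstein_exists_heegnerField_split_twist_ne_zero_of_hoffsteinLuo`); the twist is again
non-split multiplicative at `p`, its non-split function `M` has `M(0) = 2·L(E^{K'},1)/Ω⁺ ≠ 0`, so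
`[T¹](L·M) = [T¹]L · M(0) ≠ 0`; by the `p`-adic Gross–Zagier formula the Heegner point `P_{K'} ∈ E(K')` is then of
infinite order; by Gross–Zagier `L'(E/K', 1) ≠ 0`, so `ord_{s=1} L(E/K', s) ≤ 1`, and Artin formalism gives
`ord_{s=1} L(E, s) ≤ 1`, hence `= 1`.

* §1 `analyticRank_eq_one_of_multOrder_eq_one_of_padicGZ` — `K'` GIVEN (every `ℓ ∣ N_E` split, `p` split,
  `L(E^{(d_{K'})},1) ≠ 0`), `ord_{T=0} L = 1` for THE non-split function of ONE newform ⟹ `r_an(E) = 1`.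
* §2 `analyticRank_eq_one_of_multOrder_eq_one_of_odd_of_padicGZ` — `K'` SUPPLIED from `r_an(E)` odd.
* §3 `analyticRank_eq_one_of_analyticLambdaEq_one_of_padicGZ` — VERBATIM the conclusion and data of w5's
  `…LamOneRankOne.analyticRank_eq_one_of_analyticLambdaEq_one_of_odd` (`(μ_an, λ_an) = (0,1)` ∧ `r_an` odd ⟹ `r_an = 1`)
  with `hDD` + `hKY` REPLACED by `hDGZ` (+ the PUB conjuncts `hnf`, `hHL`, `hGZ`); Wuthrich Thm. 16 is used only to
  produce an integral `g` with `ι g = ϖ·L` (so that `λ_an` is defined) and `ord_T g ≤ λ(g) = 1`.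
* §4 `analyticRank_eq_one_of_orderOne_of_padicGZ` — VERBATIM the conclusion and data of w5's
  `…OrderOneRankOne.analyticRank_eq_one_of_orderOne_of_odd` (certificate `hordL`) with `hWu`, `hred`, `hDD`, `hKY` gone.

References: [Disegni2020] §2.2 Thm. 2.4, §3.1, §3.2.1; [Disegni2017] Thm. B; [PerrinRiou1987] §1.4 Cor. 1.8;
[GreenbergLNM1716] §4 p. 111; [GrossZagier1986] Thm. I.6.3; [HoffsteinLuo1997] Theorem; [MurtyMurty1997] Ch. 6;
[MazurTateTeitelbaum1986] §I.10, §I.14; [Wuthrich2014] Thm. 16; [BCDTJAMS2001] Thm. A.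
-/

set_option autoImplicit false

-- `Summit.BirchSwinnertonDyer.BirchSwinnertonDyer.…`: the summit and its single sub-problem share a name.
set_option linter.dupNamespace false

noncomputable section

open scoped Classical MatrixGroups ModularForm

open CongruenceSubgroup WeierstrassCurve NumberField IsDedekindDomain Field PowerSeries
  Literature.NumberTheory.EllipticCurves
  Literature.NumberTheory.GaloisRepresentations
  Literature.NumberTheory.EllipticCurves.ModularForms
  Literature.NumberTheory.EllipticCurves.Rank1Residual
  Literature.NumberTheory.EllipticCurves.Rank1Residual.Typed
  Literature.NumberTheory.EllipticCurves.Wuthrich2014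
  Literature.NumberTheory.EllipticCurves.Disegni2020
  Summit.BirchSwinnertonDyer.Rank1Residual
  Summit.BirchSwinnertonDyer.Rank1Residual.X2
  Summit.BirchSwinnertonDyer.Rank1Residual.X1.MuLambda
  Summit.BirchSwinnertonDyer.Rank1Residual.X1.RankOneParitySqueeze
  Summit.BirchSwinnertonDyer.BirchSwinnertonDyer.Theorems.EisensteinPrimesMazurMCOnCellBTwistbackLamOneRankOne

namespace Summit.BirchSwinnertonDyer.BirchSwinnertonDyer.Theorems.EisensteinPrimesMultOrderOnePAdicGZ

/-! ## §1. Perrin-Riou's argument at a non-split multiplicative prime, the auxiliary field GIVEN -/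

/-- **A simple zero of THE non-split Mazur–Tate–Teitelbaum function forces `ord_{s=1} L(E, s) = 1`, auxiliary field
given** (Perrin-Riou 1987 §1.4 / Greenberg LNM 1716 §4 p. 111 read backwards, at a NON-SPLIT multiplicative prime with
Disegni's `p`-adic Gross–Zagier formula). Data: `W/ℚ` globally minimal, `p ≠ 2` of non-split multiplicative reduction,
`K` imaginary quadratic with every prime of `N_E` split and `p` split, `L(E^{(d_K)}, 1) ≠ 0`, a newform `f` of `W` and
THE non-split function `L` of `f` with `ord_{T=0} L = 1`. Proof: `L(0) = 2[0]⁺_f = 0` gives `L(E,1) = 0`, so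
`r_an ≥ 1`; the twist `E^{(d_K)}` is non-split multiplicative at `p` (`p ∤ d_K`, Silverman VII.5.1), its newform `g`
(`hmod`) has THE non-split function `M` with `M(0) = 2[0]⁺_g ≠ 0`, so `ord_T(L·M) = 1` and `[T¹](L·M) ≠ 0`; Disegni's
formula (`hDGZ`) makes the Heegner point `P_K` (from `hpar`, Gross–Zagier I.§4) of infinite order; Gross–Zagier (`hGZ`)
gives `L'(E/K,1) ≠ 0`, so `ord L(E/K) ≤ 1 = ord L(E) + ord L(E^{(d_K)})` (Artin formalism). PUB inputs only.
[cite: Disegni2020, §2.2 Thm. 2.4 and §3.2.1] [cite: PerrinRiou1987, §1.4 Cor. 1.8] [cite: GreenbergLNM1716, §4 p. 111]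
[cite: GrossZagier1986, Thm. I.6.3] [cite: MazurTateTeitelbaum1986, §I.14] -/
theorem analyticRank_eq_one_of_multOrder_eq_one_of_padicGZ (hDGZ : padicGrossZagier_nonsplitMult)
    (hGZ : ∀ (N : ℕ) [NeZero N] (W : WeierstrassCurve ℚ) (K : Type) [Field K] [NumberField K],
      gross_zagier N W K)
    (hpar : nonempty_modularParametrizationData) (hmod : exists_isNewformOf)
    (W : WeierstrassCurve ℚ) [W.IsElliptic] [W.IsGloballyMinimal] (p : ℕ) [Fact p.Prime]
    (hp2 : p ≠ 2) (hmult : W.HasMultiplicativeReductionAtPrime p)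
    (hns : ¬ W.HasSplitMultiplicativeReductionAtPrime p)
    (K : Type) [Field K] [NumberField K] (hK : IsImaginaryQuadratic K)
    (hH : SatisfiesHeegnerHypothesis (W.conductorNorm ℤ) K) (hHp : SatisfiesHeegnerHypothesis p K)
    (hL1 : (W.quadraticTwist (NumberField.discr K : ℚ)).entireLFunction 1 ≠ 0)
    {N : ℕ} [NeZero N] {f : CuspForm (Gamma0 N) 2} (hf : IsNewformOf W f)
    {L : PowerSeries ℚ_[p]} (hL : IsMultPAdicLFunctionOf f p (-1) L) (h1 : L.order = 1) :
    W.analyticRank = 1 := by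
  have hpP : p.Prime := Fact.out
  haveI : NeZero (W.conductorNorm ℤ) := ⟨(W.conductorNorm_pos_holds).ne'⟩
  have h1' : L.order = ((1 : ℕ) : ℕ∞) := by rw [h1]; rfl
  -- lower bound: `L(0) = 2·[0]⁺_f = 0 ⟹ L(E, 1) = 0 ⟹ ord ≥ 1`
  have hc0 : PowerSeries.constantCoeff L = 0 := by
    rw [← PowerSeries.coeff_zero_eq_constantCoeff_apply]
    exact (PowerSeries.order_eq_nat.mp h1').2 0 Nat.zero_lt_one
  have hsym0 : ratPlusSymbol f 0 = 0 := by
    have h := hL.constantCoeff_of_neg_one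
    rw [hc0] at h
    have h' : (ratPlusSymbol f 0 : ℚ_[p]) = 0 := by
      rcases mul_eq_zero.mp h.symm with h2 | h2
      · norm_num at h2
      · exact h2
    exact_mod_cast h'
  have hL0 : W.entireLFunction 1 = 0 := by
    rw [hf.entireLFunction_one_eq, hsym0]; simp
  have hE : W.HasEntireLFunction := hf.hasEntireLFunction
  have hr1 : 1 ≤ W.analyticRank :=
    Nat.one_le_iff_ne_zero.mpr (analyticRank_ne_zero_of_entireLFunction_one_eq_zero W hE hL0)
  -- `(d_K, N_E) = 1`, `p` split, `p ∤ d_K`, a Heegner point, the newform of the twist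
  have hcop : IsCoprime (NumberField.discr K) (W.conductorNorm ℤ : ℤ) := by
    rw [Int.isCoprime_iff_gcd_eq_one, Int.gcd_comm]
    exact Literature.SatisfiesHeegnerHypothesis.coprime_discr hK.1 hH
  have hsplit : ((Ideal.span {(p : ℤ)}).primesOver (𝓞 K)).ncard = 2 := hHp p hpP dvd_rfl
  have hpd : ¬ (p : ℤ) ∣ NumberField.discr K := not_dvd_discr_of_split hK hpP hp2 hHp
  obtain ⟨P, hP⟩ := exists_isHeegnerPoint_of_nonempty_modularParametrizationData W K hpar hK hH
  have hdK : (NumberField.discr K : ℚ) ≠ 0 := by exact_mod_cast NumberField.discr_ne_zero K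
  haveI := W.isElliptic_quadraticTwist hdK
  haveI : NeZero ((W.quadraticTwist (NumberField.discr K : ℚ)).conductorNorm ℤ) :=
    ⟨((W.quadraticTwist (NumberField.discr K : ℚ)).conductorNorm_pos_holds).ne'⟩
  obtain ⟨g, hg⟩ := hmod (W.quadraticTwist (NumberField.discr K : ℚ))
  -- the twist is NON-split multiplicative at `p`
  have hmult' : (W.quadraticTwist (NumberField.discr K : ℚ)).HasMultiplicativeReductionAtPrime p :=
    X2.hasMultiplicativeReductionAtPrime_of_smul_eq_quadraticTwist W (W.quadraticTwist (NumberField.discr K : ℚ))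
      (C := (1 : VariableChange ℚ)) (one_smul _ _) p hp2 hpd hmult
  obtain ⟨C₀, hC₀⟩ := hasGlobalMinimalModel_rat_holds (W.quadraticTwist (NumberField.discr K : ℚ))
  have hns' : ¬ (W.quadraticTwist (NumberField.discr K : ℚ)).HasSplitMultiplicativeReductionAtPrime p := by
    set Wd : WeierstrassCurve ℚ := C₀ • W.quadraticTwist (NumberField.discr K : ℚ) with hWd_def
    haveI : Wd.IsGloballyMinimal := hC₀
    have hCd : C₀⁻¹ • Wd = W.quadraticTwist (NumberField.discr K : ℚ) := inv_smul_smul C₀ _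
    have hnsd : ¬ Wd.HasSplitMultiplicativeReductionAtPrime p :=
      X2.not_hasSplitMultiplicativeReductionAtPrime_of_smul_eq_quadraticTwist W Wd hK p hp2 hmult hns hHp hCd
    intro hs
    rw [← hCd] at hs
    exact hnsd ((hasSplitMultiplicativeReductionAtPrime_smul_iff Wd C₀⁻¹ p).mp hs)
  obtain ⟨M, hM⟩ := exists_isMultPAdicLFunctionOf_neg_one_of_nonsplit hg hmult' hns'
  -- the twist factor has order `0`: `M(0) = 2·[0]⁺_g ≠ 0` since `L(E^{(d_K)}, 1) ≠ 0`
  have hsymg : ratPlusSymbol g 0 ≠ 0 := by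
    intro h0
    apply hL1
    rw [hg.entireLFunction_one_eq, h0]; simp
  have hM0 : PowerSeries.constantCoeff M ≠ 0 := by
    rw [hM.constantCoeff_of_neg_one]
    exact mul_ne_zero two_ne_zero (by exact_mod_cast hsymg)
  have hordM : M.order = 0 := by
    have h0 : ((0 : ℕ) : ℕ∞) = 0 := Nat.cast_zero
    rw [← h0, PowerSeries.order_eq_nat]
    exact ⟨by rwa [PowerSeries.coeff_zero_eq_constantCoeff_apply], fun i hi ↦ absurd hi (Nat.not_lt_zero i)⟩
  -- so `L·M` has a SIMPLE zero at `T = 0`: `[T¹](L·M) ≠ 0`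
  have hLM : (L * M).order = ((1 : ℕ) : ℕ∞) := by
    rw [PowerSeries.order_mul, h1', hordM, add_zero]
  have hcoeff : PowerSeries.coeff 1 (L * M) ≠ 0 := (PowerSeries.order_eq_nat.mp hLM).1
  -- Disegni's `p`-adic Gross–Zagier formula: the Heegner point has infinite order
  have hnt : ¬ IsOfFinAddOrder P := fun ht ↦
    hcoeff (hDGZ W p K (W.conductorNorm ℤ) hf hg hp2 hmult hns hK hcop rfl hH hsplit L M hL hM P hP ht)
  -- Gross–Zagier: `L'(E/K, 1) ≠ 0`, so `ord_{s=1} L(E/K, s) ≤ 1`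
  have hLd : LDerivEK W K ≠ 0 :=
    (lDerivEK_ne_zero_iff_not_isOfFinAddOrder W (W.conductorNorm ℤ) K (hGZ _ W K) hK hH hP).mpr hnt
  have hEt : (W.quadraticTwist (NumberField.discr K : ℚ)).HasEntireLFunction := hg.hasEntireLFunction
  have hEKle : analyticRankEK W K ≤ 1 := by
    by_contra hlt
    exact hLd (lDerivEK_eq_zero_of_two_le_analyticRankEK W K hE hEt (by omega))
  -- Artin formalism: `ord L(E/K) = ord L(E) + ord L(E^{(d_K)})`
  have hadd := analyticRankEK_eq_add_of (hasEntireLFunction_rat_of_exists_isNewformOf hmod) W K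
  omega

/-! ## §2. The auxiliary field SUPPLIED (Hoffstein–Luo + sign) from an odd analytic rank -/

/-- **`ord_{T=0} L_p(E,T) = 1` ∧ `r_an(E)` odd ⟹ `ord_{s=1} L(E,s) = 1` at a non-split multiplicative prime, PUBLISHED
inputs only.** As §1, the auxiliary field being supplied: `r_an` odd gives `w(E) = −1` (modularity,
`even_analyticRank_iff_rootNumber_eq_one_of_exists_isNewformOf`), and Hoffstein–Luo's theorem with the sign obstruction
(`friedbergHoffstein_exists_heegnerField_split_twist_ne_zero_of_hoffsteinLuo`, from `hmod` + `hHL`) gives an imaginary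
quadratic `K` with every `ℓ ∣ N_E` split, `p` split and `L(E^{(d_K)},1) ≠ 0`.
[cite: Disegni2020, §2.2 Thm. 2.4 and §3.2.1] [cite: HoffsteinLuo1997, Theorem (§1)] [cite: MurtyMurty1997, Ch. 6 §1, p. 96]
[cite: PerrinRiou1987, §1.4 Cor. 1.8] [cite: GrossZagier1986, Thm. I.6.3] -/
theorem analyticRank_eq_one_of_multOrder_eq_one_of_odd_of_padicGZ (hDGZ : padicGrossZagier_nonsplitMult)
    (hGZ : ∀ (N : ℕ) [NeZero N] (W : WeierstrassCurve ℚ) (K : Type) [Field K] [NumberField K],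
      gross_zagier N W K)
    (hpar : nonempty_modularParametrizationData) (hmod : exists_isNewformOf)
    (hHL : HoffsteinLuo1997_exists_twist_L_one_ne_zero)
    (W : WeierstrassCurve ℚ) [W.IsElliptic] [W.IsGloballyMinimal] (p : ℕ) [Fact p.Prime]
    (hp2 : p ≠ 2) (hmult : W.HasMultiplicativeReductionAtPrime p)
    (hns : ¬ W.HasSplitMultiplicativeReductionAtPrime p) (hodd : Odd W.analyticRank)
    {N : ℕ} [NeZero N] {f : CuspForm (Gamma0 N) 2} (hf : IsNewformOf W f)
    {L : PowerSeries ℚ_[p]} (hL : IsMultPAdicLFunctionOf f p (-1) L) (h1 : L.order = 1) :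
    W.analyticRank = 1 := by
  have hpP : p.Prime := Fact.out
  -- `w(E) = −1`
  have hw : W.rootNumber = -1 := by
    rcases rootNumber_eq_one_or_eq_neg_one (W := W) with h | h
    · exact absurd ((even_analyticRank_iff_rootNumber_eq_one_of_exists_isNewformOf W hmod).mpr h)
        (Nat.not_even_iff_odd.mpr hodd)
    · exact h
  -- the auxiliary field
  obtain ⟨K, _, _, hK, -, hH, hHp, hL1⟩ :=
    friedbergHoffstein_exists_heegnerField_split_twist_ne_zero_of_hoffsteinLuo hmod hHL W hw p hpP 0
  exact analyticRank_eq_one_of_multOrder_eq_one_of_padicGZ hDGZ hGZ hpar hmod W p hp2 hmult hns K hK hH hHp hL1 hf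
    hL h1

/-! ## §3. `(μ_an, λ_an) = (0, 1)` ∧ `r_an` odd ⟹ `ord_{s=1} L(E, s) = 1` — w5's road (d′) core WITHOUT Keller–Yin -/

/-- **Road (d′), core, PUBLISHED inputs only: `(μ_an, λ_an) = (0, 1)` ∧ `r_an` odd ⟹ `ord_{s=1} L(E, s) = 1` at a
non-split multiplicative Eisenstein prime `p ≠ 2`** — the data and conclusion of
`…TwistbackLamOneRankOne.analyticRank_eq_one_of_analyticLambdaEq_one_of_odd` VERBATIM, its named facts `hDD`
(Dokchitser) and `hKY` (Keller–Yin Thm. E, PRE) REPLACED by `hDGZ` (Disegni 2020 Thm. 2.4, PUB) and the PUB conjuncts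
`hnf`/`hHL`/`hGZ` of `PublishedInputs`. Proof: Wuthrich Thm. 16 (`hWu`) gives an integral `g ∈ char_Λ X` with
`ι g = ϖ·L`; `λ(g) = 1` (`hlam`) and `g ≠ 0` (`hμ0`) give `ord_T g ≤ 1`, hence `ord_T L ≤ 1` (`ι` preserves the order,
`ϖ ≠ 0`); `r_an` odd gives `L(E,1) = 0`, so `L(0) = 2[0]⁺_f = 0` and `ord_T L ≥ 1`; then §2. NO Selmer corank, NO parity,
NO `p`-converse. [cite: Disegni2020, §2.2 Thm. 2.4 and §3.2.1] [cite: Wuthrich2014, Thm. 16 (p. 397)]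
[cite: PerrinRiou1987, §1.4 Cor. 1.8] [cite: GreenbergLNM1716, §4 p. 111] -/
theorem analyticRank_eq_one_of_analyticLambdaEq_one_of_padicGZ
    (hWu : thm16_charIdeal_dvd_multiplicative_of_reducible) (hpar : nonempty_modularParametrizationData)
    (hnf : exists_isNewformOf) (hHL : HoffsteinLuo1997_exists_twist_L_one_ne_zero)
    (hGZ : ∀ (N : ℕ) [NeZero N] (W : WeierstrassCurve ℚ) (K : Type) [Field K] [NumberField K],
      gross_zagier N W K)
    (hDGZ : padicGrossZagier_nonsplitMult)
    (W : WeierstrassCurve ℚ) [W.IsElliptic] [W.IsGloballyMinimal] (p : ℕ) [Fact p.Prime]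
    (hp2 : p ≠ 2) (hmult : W.HasMultiplicativeReductionAtPrime p)
    (hns : ¬ W.HasSplitMultiplicativeReductionAtPrime p) (hred : ¬ W.HasIrreducibleModPGaloisRep p)
    (hodd : Odd W.analyticRank) (hμ0 : AnalyticMuLE W p 0) (hlam : AnalyticLambdaEq W p 1) :
    W.analyticRank = 1 := by
  have hpP : p.Prime := Fact.out
  -- the cyclotomic datum, the Selmer dual, a newform with its `ϖ`, THE non-split `p`-adic `L`-function
  obtain ⟨κ, hκ, γ, hγ, hγ'⟩ := exists_isCyclotomic_isTopGenerator_isCyclotomicVariable_holds p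
  obtain ⟨D⟩ := W.nonempty_selmerDualData_holds κ γ hγ
  haveI : NeZero (W.conductorNorm ℤ) := ⟨(W.conductorNorm_pos_holds).ne'⟩
  obtain ⟨Dm⟩ := hpar W
  obtain ⟨ϖ, -, hϖ, -⟩ := Dm.exists_rat_mul_realPeriodRat_eq_plusPeriod
  obtain ⟨L, hL⟩ := exists_isMultPAdicLFunctionOf_neg_one_of_nonsplit Dm.isNewformOf hmult hns
  haveI : Module.Finite (IwasawaAlgebra p) D.X := D.module_finite_holds hγ
  -- Wuthrich Thm. 16: an integral `g` with `ι g = ϖ·L`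
  obtain ⟨-, hKns, -⟩ := hWu W p hp2 hmult hred hκ hγ hγ' Dm.isNewformOf D ϖ hϖ
  obtain ⟨g, -, hιg⟩ := hKns hns L hL
  -- `λ(g) = 1`, `g ≠ 0`, hence `ord_T g ≤ 1`
  have hlamg : lam g = 1 :=
    hlam Dm.f Dm.isNewformOf ϖ hϖ L (fun hs ↦ absurd hs hns) (fun _ ↦ hL) g hιg
  obtain ⟨k, hk⟩ := hμ0 Dm.f Dm.isNewformOf ϖ hϖ L (fun hs ↦ absurd hs hns) (fun _ ↦ hL)
  have hL0 : PowerSeries.C ((ϖ : ℚ) : ℚ_[p]) * L ≠ 0 := ne_zero_of_lt_norm_coeff hk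
  have hg0 : g ≠ 0 := by
    rintro rfl
    exact hL0 (by rw [← hιg, map_zero])
  have hordg : g.order ≤ ((1 : ℕ) : ℕ∞) := by
    rw [← hlamg]; exact order_le_lam hg0
  -- `ord_T ι(g) = ord_T g` and `ord_T (ϖ·L) = ord_T L` (`ϖ ≠ 0`)
  have hι : (iwasawaToPowerSeries p g).order = g.order := by
    refine le_antisymm ?_ (PowerSeries.le_order_map _)
    refine PowerSeries.le_order _ _ fun i hi ↦ ?_
    have h := PowerSeries.coeff_of_lt_order i hi
    have hinj : Function.Injective (algebraMap ℤ_[p] ℚ_[p]) := Subtype.coe_injective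
    rw [PowerSeries.coeff_map] at h
    exact hinj (h.trans (map_zero (algebraMap ℤ_[p] ℚ_[p])).symm)
  have hϖ0 : ((ϖ : ℚ) : ℚ_[p]) ≠ 0 := by
    intro h0
    exact hL0 (by rw [h0, map_zero, zero_mul])
  have hCϖ : IsUnit (PowerSeries.C ((ϖ : ℚ) : ℚ_[p])) := IsUnit.map PowerSeries.C (IsUnit.mk0 _ hϖ0)
  have hordL : L.order = g.order := by
    rw [← hι, hιg, PowerSeries.order_mul, PowerSeries.order_zero_of_unit hCϖ, zero_add]
  have hle : L.order ≤ ((1 : ℕ) : ℕ∞) := hordL ▸ hordg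
  -- `r_an` odd ⟹ `L(E, 1) = 0` ⟹ `L(0) = 2·[0]⁺_f = 0` ⟹ `ord_T L ≥ 1`
  have hw : W.rootNumber = -1 := by
    rcases rootNumber_eq_one_or_eq_neg_one (W := W) with h | h
    · exact absurd ((even_analyticRank_iff_rootNumber_eq_one_of_exists_isNewformOf W hnf).mpr h)
        (Nat.not_even_iff_odd.mpr hodd)
    · exact h
  have hLE0 : W.entireLFunction 1 = 0 := entireLFunction_one_eq_zero_of_rootNumber_eq_neg_one hw
  have hsym0 : ratPlusSymbol Dm.f 0 = 0 := by
    have h := Dm.isNewformOf.entireLFunction_one_eq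
    rw [hLE0] at h
    have hpos : 0 < plusPeriod Dm.f := IsNewform0.plusPeriod_pos_holds Dm.isNewformOf.1 Dm.isNewformOf.coeffField_eq_bot
    have h' : (((ratPlusSymbol Dm.f 0 : ℚ) : ℝ) * plusPeriod Dm.f : ℝ) = 0 := by exact_mod_cast h.symm
    rcases mul_eq_zero.mp h' with h2 | h2
    · exact_mod_cast h2
    · exact absurd h2 hpos.ne'
  have hc0 : PowerSeries.constantCoeff L = 0 := by
    rw [hL.constantCoeff_of_neg_one, hsym0]; simp
  have hge : ((1 : ℕ) : ℕ∞) ≤ L.order := by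
    refine PowerSeries.nat_le_order _ 1 fun i hi ↦ ?_
    obtain rfl : i = 0 := by omega
    rwa [PowerSeries.coeff_zero_eq_constantCoeff_apply]
  have h1 : L.order = 1 := le_antisymm hle hge
  exact analyticRank_eq_one_of_multOrder_eq_one_of_odd_of_padicGZ hDGZ hGZ hpar hnf hHL W p hp2 hmult hns hodd
    Dm.isNewformOf hL h1

/-! ## §4. The `L`-function-certificate form (`hordL`) — w5's road (c′) core WITHOUT Kato / parity / Keller–Yin -/

/-- **Road (c′), core, PUBLISHED inputs only: the certificate `ord_{T=0} L_p(E, T) = 1` gives the analytic rank** —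
the data and conclusion of `…TwistbackOrderOneRankOne.analyticRank_eq_one_of_orderOne_of_odd` with `hWu`, `hred`, `hDD`,
`hKY` REMOVED and `hDGZ` (Disegni 2020 Thm. 2.4, PUB) + the PUB conjuncts `hmod`/`hHL`/`hGZ` added: `W/ℚ` globally
minimal, `p ≠ 2` non-split multiplicative, `r_an` odd, `ord_{T=0} L = 1` for THE non-split function of every newform /
`ϖ` of `W` ⟹ `ord_{s=1} L(E, s) = 1` (instantiated at the newform of a parametrisation datum, `hpar`, and THE non-split
function, `exists_isMultPAdicLFunctionOf_neg_one_of_nonsplit`; then §2).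
[cite: Disegni2020, §2.2 Thm. 2.4 and §3.2.1] [cite: PerrinRiou1987, §1.4 Cor. 1.8] [cite: GreenbergLNM1716, §4 p. 111] -/
theorem analyticRank_eq_one_of_orderOne_of_padicGZ (hpar : nonempty_modularParametrizationData)
    (hmod : exists_isNewformOf) (hHL : HoffsteinLuo1997_exists_twist_L_one_ne_zero)
    (hGZ : ∀ (N : ℕ) [NeZero N] (W : WeierstrassCurve ℚ) (K : Type) [Field K] [NumberField K],
      gross_zagier N W K)
    (hDGZ : padicGrossZagier_nonsplitMult)
    (W : WeierstrassCurve ℚ) [W.IsElliptic] [W.IsGloballyMinimal] (p : ℕ) [Fact p.Prime]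
    (hp2 : p ≠ 2) (hmult : W.HasMultiplicativeReductionAtPrime p)
    (hns : ¬ W.HasSplitMultiplicativeReductionAtPrime p) (hodd : Odd W.analyticRank)
    (hordL : ∀ {N : ℕ} [NeZero N] (f : CuspForm (Gamma0 N) 2), IsNewformOf W f →
      ∀ (ϖ : ℚ), (ϖ : ℝ) * W.realPeriodRat = plusPeriod f →
      ∀ L : PowerSeries ℚ_[p], IsMultPAdicLFunctionOf f p (-1) L → L.order = ((1 : ℕ) : ℕ∞)) :
    W.analyticRank = 1 := by
  haveI : NeZero (W.conductorNorm ℤ) := ⟨(W.conductorNorm_pos_holds).ne'⟩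
  obtain ⟨Dm⟩ := hpar W
  obtain ⟨ϖ, -, hϖ, -⟩ := Dm.exists_rat_mul_realPeriodRat_eq_plusPeriod
  obtain ⟨L, hL⟩ := exists_isMultPAdicLFunctionOf_neg_one_of_nonsplit Dm.isNewformOf hmult hns
  have h1 : L.order = 1 := by rw [hordL Dm.f Dm.isNewformOf ϖ hϖ L hL]; rfl
  exact analyticRank_eq_one_of_multOrder_eq_one_of_odd_of_padicGZ hDGZ hGZ hpar hmod hHL W p hp2 hmult hns hodd
    Dm.isNewformOf hL h1

end Summit.BirchSwinnertonDyer.BirchSwinnertonDyer.Theorems.EisensteinPrimesMultOrderOnePAdicGZ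

end
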